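import Summits.SmoothPoincare4.SmoothPoincare4.Theorems.ConvexBisectionAcyclicBisectionExistsHgapTwistChart3
import HarnessLib

/-!
# Hgap ▸ part B (page twisting of the straightened dual framed knot), brick H1-a (sphere side):
# the orientation character of the three-dimensional belt-tube chart has constant sign
(wave 7, crux stmt-SmoothPoincare4-10508, line `modp-braid-orbits`, stub `stub_T3_dualPresentation` (T3)
▸ node `Hgap` ▸ part B `helper_Hgap_twisting` ▸ (R6a′); registered sub-goal `helper_beltChar_radialConst`)

G2's file `…HgapTwistChart3.lean` introduced the three-dimensional belt-tube chart of the `j`-th handle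
pushed through the seam and a `rho`-preserving diffeomorphism `E` of the base,
`Γ̂ (p) = (E (seam (β♭ (circlePt (p 2), L p)))).1 ∈ ℝ⁴` (`β♭ = (beltMap D j).boundaryTube`, `L p = (p 0, p 1)`
the fibre part), and proved that its `det4`-ORIENTATION CHARACTER
`χ (p) = det4 (∇rho (Γ̂ p), dΓ̂ e₀, dΓ̂ e₁, dΓ̂ e₂)` never vanishes on the chart domain `U = {‖L p‖ < 1}`
(`det4_beltChart₃_ne_zero`).  This file adds the continuity half of the transfer step (R6) of
`G2-REPORT.md` §4:

* §1 `Γ̂` is `C^∞` on `U` (`contDiffAt_beltChart₃`, `contDiffOn_beltChart₃`: every factor is smooth), so its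
  columns `p ↦ dΓ̂ eₖ = fderiv Γ̂ p eₖ` and `χ` are continuous on `U` (`continuousOn_beltChar`);
* §2 `U` is convex, hence preconnected, so **`χ` has ONE sign on the whole chart domain**:
  `0 < χ p · χ p'` for all `p, p' ∈ U` (`beltChar_sign_const`; registered in `let`-form as
  `helper_beltChar_radialConst`).  In particular the sign at a belt point `(0, 0, φ)` (computed by
  `helper_det4_beltFrame_sign`, the page sign `σ̂`) equals the sign at any glued point `(m, φ')`, `m ≠ 0`
  (computed through the factorisation `Γ̂ = (R₁ ∘ seamB) ∘ η̂`, files `…HgapCharGlued.lean` and H2's tube side).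

Everything is proved; no named facts, no `sorry`.  References: J. M. Lee, *Introduction to Smooth Manifolds*
(2013), Prop. 15.24 [LeeSmoothManifolds2013]; A. A. Kosinski, *Differential Manifolds* (1993), VI §6 [Kosinski1993].
-/

noncomputable section

set_option linter.dupNamespace false

open scoped Manifold ContDiff Topology RealInnerProductSpace
open Set Function Metric
open Literature.Topology.FourManifolds Literature.Topology.FourManifolds.HandleAttachingMap
  Literature.Topology.FourManifolds.LefschetzBase Literature.Geometry.Symplectic

namespace Summit.SmoothPoincare4.SmoothPoincare4.Theorems.AcyclicBisectionExists.ModpBraidOrbits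

section Chart

variable {g : ℕ} {ι : Type} [Finite ι] {h : ι → HandleAttachingMap 3 2 (Base g)}
  {X : Type} [TopologicalSpace X] [ChartedSpace (EuclideanHalfSpace 4) X] [IsManifold (𝓡∂ 4) ∞ X]
  (D : MultiAttachmentData h (𝓡∂ 4) X) (bX : BoundaryData (𝓡∂ 4) X (𝓡 3))
  (Ψ : bX.carrier ≃ₘ⟮𝓡 3, 𝓡 3⟯ (bBase g).carrier) (E : Base g ≃ₘ^∞⟮𝓡∂ 4, 𝓡∂ 4⟯ Base g) (j : ι)
  {L : EuclideanSpace ℝ (Fin 3) →L[ℝ] EuclideanSpace ℝ (Fin 2)}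

/-! ## §1 Smoothness of the chart and continuity of its orientation character -/

/-- **The three-dimensional belt-tube chart is smooth on the chart domain**: at every `p` with
`‖L p‖ < 1`, `Γ̂ = val ∘ E ∘ seam ∘ β♭ ∘ (p ↦ (circlePt (p 2), L p))` is `C^∞` (every factor is).
[cite: Kosinski1993, VI §6] -/
theorem contDiffAt_beltChart₃ (p : EuclideanSpace ℝ (Fin 3)) (hp : ‖L p‖ < 1) :
    ContDiffAt ℝ ∞ (fun p : EuclideanSpace ℝ (Fin 3) => (E ((BoundaryManifold.boundaryData 3 (Base g)).incl
      (seamDiffeo bX (bBase g) Ψ ((beltMap D j).boundaryTube.toHomeo (circlePt (p 2), L p))))).1) p := by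
  have hπ : ContMDiff 𝓘(ℝ, EuclideanSpace ℝ (Fin 3)) 𝓘(ℝ, ℝ) ∞ (fun p : EuclideanSpace ℝ (Fin 3) => p 2) :=
    (EuclideanSpace.proj (𝕜 := ℝ) (2 : Fin 3)).contDiff.contMDiff
  have h1 : ContMDiffAt 𝓘(ℝ, EuclideanSpace ℝ (Fin 3)) ((𝓡 1).prod 𝓘(ℝ, EuclideanSpace ℝ (Fin 2))) ∞
      (fun p : EuclideanSpace ℝ (Fin 3) => ((circlePt (p 2), L p) :
        (sphere (0 : EuclideanSpace ℝ (Fin 2)) 1) × EuclideanSpace ℝ (Fin 2))) p :=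
    (contMDiff_circlePt.comp hπ).contMDiffAt.prodMk L.contDiff.contMDiff.contMDiffAt
  have hsrc : ((circlePt (p 2), L p) : (sphere (0 : EuclideanSpace ℝ (Fin 2)) 1) × EuclideanSpace ℝ (Fin 2)) ∈
      (beltMap D j).boundaryTube.toHomeo.source := by
    rw [CircleTube.mem_source_iff]; exact hp
  have h2 : ContMDiffAt ((𝓡 1).prod 𝓘(ℝ, EuclideanSpace ℝ (Fin 2))) (𝓡 3) ∞
      (beltMap D j).boundaryTube.toHomeo ((circlePt (p 2), L p) :
        (sphere (0 : EuclideanSpace ℝ (Fin 2)) 1) × EuclideanSpace ℝ (Fin 2)) :=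
    (beltMap D j).boundaryTube.contMDiffAt_toHomeo hsrc
  have h3 : ContMDiff (𝓡 3) (𝓡∂ 4) ∞ (fun y => (BoundaryManifold.boundaryData 3 (Base g)).incl
      (seamDiffeo bX (bBase g) Ψ y)) :=
    (BoundaryManifold.boundaryData 3 (Base g)).isSmoothEmbedding.contMDiff.comp
      (seamDiffeo bX (bBase g) Ψ).contMDiff
  have h4 : ContMDiff (𝓡∂ 4) 𝓘(ℝ, EuclideanSpace ℝ (Fin 4)) ∞ (fun x : Base g => (E x).1) :=
    (RegularSublevel.contMDiff_incl (isRegularLevel_rho g)).comp E.contMDiff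
  have hc := ((h4.comp h3).contMDiffAt.comp _ h2).comp p h1
  exact contMDiffAt_iff_contDiffAt.1 hc

/-- The chart domain `{‖L p‖ < 1}` is open. [folklore] -/
theorem isOpen_beltChartDom (L : EuclideanSpace ℝ (Fin 3) →L[ℝ] EuclideanSpace ℝ (Fin 2)) :
    IsOpen {p : EuclideanSpace ℝ (Fin 3) | ‖L p‖ < 1} :=
  isOpen_lt (continuous_norm.comp L.continuous) continuous_const

/-- The chart domain `{‖L p‖ < 1}` is convex. [folklore] -/
theorem convex_beltChartDom (L : EuclideanSpace ℝ (Fin 3) →L[ℝ] EuclideanSpace ℝ (Fin 2)) :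
    Convex ℝ {p : EuclideanSpace ℝ (Fin 3) | ‖L p‖ < 1} := by
  have e : {p : EuclideanSpace ℝ (Fin 3) | ‖L p‖ < 1} =
      (L : EuclideanSpace ℝ (Fin 3) →ₗ[ℝ] EuclideanSpace ℝ (Fin 2)) ⁻¹' ball (0 : EuclideanSpace ℝ (Fin 2)) 1 := by
    ext p; simp
  rw [e]
  exact (convex_ball (0 : EuclideanSpace ℝ (Fin 2)) 1).linear_preimage _

/-- **The chart is smooth on the chart domain.** [cite: Kosinski1993, VI §6] -/
theorem contDiffOn_beltChart₃ :
    ContDiffOn ℝ ∞ (fun p : EuclideanSpace ℝ (Fin 3) => (E ((BoundaryManifold.boundaryData 3 (Base g)).incl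
      (seamDiffeo bX (bBase g) Ψ ((beltMap D j).boundaryTube.toHomeo (circlePt (p 2), L p))))).1)
      {p : EuclideanSpace ℝ (Fin 3) | ‖L p‖ < 1} :=
  fun p hp => (contDiffAt_beltChart₃ D bX Ψ E j p hp).contDiffWithinAt

/-- **The columns of the chart are continuous on the chart domain**: `p ↦ dΓ̂_p (u)` is continuous on
`{‖L p‖ < 1}` for every fixed `u`. [folklore] -/
theorem continuousOn_mfderiv_beltChart₃ (u : EuclideanSpace ℝ (Fin 3)) :
    ContinuousOn (fun p : EuclideanSpace ℝ (Fin 3) =>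
      mfderiv 𝓘(ℝ, EuclideanSpace ℝ (Fin 3)) 𝓘(ℝ, EuclideanSpace ℝ (Fin 4))
        (fun p : EuclideanSpace ℝ (Fin 3) => (E ((BoundaryManifold.boundaryData 3 (Base g)).incl
          (seamDiffeo bX (bBase g) Ψ ((beltMap D j).boundaryTube.toHomeo (circlePt (p 2), L p))))).1) p u)
      {p : EuclideanSpace ℝ (Fin 3) | ‖L p‖ < 1} := by
  have hF := (contDiffOn_beltChart₃ D bX Ψ E j (L := L)).continuousOn_fderiv_of_isOpen (isOpen_beltChartDom L)
    (by simp)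
  have h := hF.clm_apply (continuousOn_const (c := u))
  refine h.congr fun p _ => ?_
  show _ = fderiv ℝ _ p u
  rw [← mfderiv_eq_fderiv]
  rfl

/-- **The orientation character of the chart is continuous on the chart domain.**
[cite: LeeSmoothManifolds2013, Prop. 15.24] -/
theorem continuousOn_beltChar :
    ContinuousOn (fun p : EuclideanSpace ℝ (Fin 3) =>
      det4 (gradient (rho g) (E ((BoundaryManifold.boundaryData 3 (Base g)).incl (seamDiffeo bX (bBase g) Ψ
          ((beltMap D j).boundaryTube.toHomeo (circlePt (p 2), L p))))).1)
        (mfderiv 𝓘(ℝ, EuclideanSpace ℝ (Fin 3)) 𝓘(ℝ, EuclideanSpace ℝ (Fin 4))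
          (fun p : EuclideanSpace ℝ (Fin 3) => (E ((BoundaryManifold.boundaryData 3 (Base g)).incl
            (seamDiffeo bX (bBase g) Ψ ((beltMap D j).boundaryTube.toHomeo (circlePt (p 2), L p))))).1) p
          (EuclideanSpace.single (0 : Fin 3) (1 : ℝ)))
        (mfderiv 𝓘(ℝ, EuclideanSpace ℝ (Fin 3)) 𝓘(ℝ, EuclideanSpace ℝ (Fin 4))
          (fun p : EuclideanSpace ℝ (Fin 3) => (E ((BoundaryManifold.boundaryData 3 (Base g)).incl
            (seamDiffeo bX (bBase g) Ψ ((beltMap D j).boundaryTube.toHomeo (circlePt (p 2), L p))))).1) p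
          (EuclideanSpace.single (1 : Fin 3) (1 : ℝ)))
        (mfderiv 𝓘(ℝ, EuclideanSpace ℝ (Fin 3)) 𝓘(ℝ, EuclideanSpace ℝ (Fin 4))
          (fun p : EuclideanSpace ℝ (Fin 3) => (E ((BoundaryManifold.boundaryData 3 (Base g)).incl
            (seamDiffeo bX (bBase g) Ψ ((beltMap D j).boundaryTube.toHomeo (circlePt (p 2), L p))))).1) p
          (EuclideanSpace.single (2 : Fin 3) (1 : ℝ))))
      {p : EuclideanSpace ℝ (Fin 3) | ‖L p‖ < 1} := by
  set U : Set (EuclideanSpace ℝ (Fin 3)) := {p | ‖L p‖ < 1} with hU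
  set Γ : EuclideanSpace ℝ (Fin 3) → EuclideanSpace ℝ (Fin 4) := fun p =>
    (E ((BoundaryManifold.boundaryData 3 (Base g)).incl (seamDiffeo bX (bBase g) Ψ
      ((beltMap D j).boundaryTube.toHomeo (circlePt (p 2), L p))))).1 with hΓ
  have hΓc : ContinuousOn Γ U := (contDiffOn_beltChart₃ D bX Ψ E j (L := L)).continuousOn
  have hgrad : ContinuousOn (fun p => gradient (rho g) (Γ p)) U :=
    (continuous_gradient_rho (g := g)).comp_continuousOn hΓc
  have hcol : ∀ k : Fin 3, ContinuousOn (fun p => mfderiv 𝓘(ℝ, EuclideanSpace ℝ (Fin 3))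
      𝓘(ℝ, EuclideanSpace ℝ (Fin 4)) Γ p (EuclideanSpace.single k (1 : ℝ))) U := fun k =>
    continuousOn_mfderiv_beltChart₃ D bX Ψ E j _
  -- pass to the subtype `U` and use the continuity of `det4` in its four arguments
  rw [continuousOn_iff_continuous_restrict]
  have ha : Continuous (U.restrict fun p => gradient (rho g) (Γ p)) :=
    continuousOn_iff_continuous_restrict.1 hgrad
  have hb : ∀ k : Fin 3, Continuous (U.restrict fun p => mfderiv 𝓘(ℝ, EuclideanSpace ℝ (Fin 3))
      𝓘(ℝ, EuclideanSpace ℝ (Fin 4)) Γ p (EuclideanSpace.single k (1 : ℝ))) := fun k =>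
    continuousOn_iff_continuous_restrict.1 (hcol k)
  exact continuous_det4_family ha (hb 0) (hb 1) (hb 2)

/-! ## §2 One sign on the whole chart domain -/

/-- A continuous nowhere-vanishing function on a convex set has one sign there. [folklore] -/
theorem mul_pos_of_continuousOn_convex {F : Type*} [AddCommGroup F] [Module ℝ F] [TopologicalSpace F]
    [IsTopologicalAddGroup F] [ContinuousSMul ℝ F] {U : Set F} (hU : Convex ℝ U) {χ : F → ℝ}
    (hc : ContinuousOn χ U) (hne : ∀ q ∈ U, χ q ≠ 0) {p p' : F} (hp : p ∈ U) (hp' : p' ∈ U) :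
    0 < χ p * χ p' := by
  -- the image `χ '' U` is an interval of `ℝ` missing `0`
  have hpre : IsPreconnected (χ '' U) := hU.isPreconnected.image χ hc
  have hord : OrdConnected (χ '' U) := isPreconnected_iff_ordConnected.1 hpre
  have hmem : χ p ∈ χ '' U := mem_image_of_mem χ hp
  have hmem' : χ p' ∈ χ '' U := mem_image_of_mem χ hp'
  have h0 : (0 : ℝ) ∉ χ '' U := by
    rintro ⟨q, hq, hq0⟩
    exact hne q hq hq0
  rcases lt_or_gt_of_ne (hne p hp) with h1 | h1 <;> rcases lt_or_gt_of_ne (hne p' hp') with h2 | h2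
  · exact mul_pos_of_neg_of_neg h1 h2
  · exact absurd (hord.out hmem hmem' ⟨h1.le, h2.le⟩) h0
  · exact absurd (hord.out hmem' hmem ⟨h2.le, h1.le⟩) h0
  · exact mul_pos h1 h2

/-- **The orientation character of the three-dimensional belt-tube chart has ONE sign on the chart
domain** (brick H1-a): for a `rho`-preserving `E` and all `p, p'` with `‖L p‖, ‖L p'‖ < 1`,
`0 < χ p · χ p'` — `χ` is continuous and never zero on the convex set `{‖L p‖ < 1}`.
[cite: LeeSmoothManifolds2013, Prop. 15.24] -/
theorem beltChar_sign_const
    (hL : ∀ (p : EuclideanSpace ℝ (Fin 3)) (i : Fin 2), L p i = p (Fin.castSucc i))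
    (hEρ : ∀ x : Base g, rho g (E x).1 = rho g x.1) (p p' : EuclideanSpace ℝ (Fin 3)) (hp : ‖L p‖ < 1)
    (hp' : ‖L p'‖ < 1) :
    0 < det4 (gradient (rho g) (E ((BoundaryManifold.boundaryData 3 (Base g)).incl (seamDiffeo bX (bBase g) Ψ
          ((beltMap D j).boundaryTube.toHomeo (circlePt (p 2), L p))))).1)
        (mfderiv 𝓘(ℝ, EuclideanSpace ℝ (Fin 3)) 𝓘(ℝ, EuclideanSpace ℝ (Fin 4))
          (fun p : EuclideanSpace ℝ (Fin 3) => (E ((BoundaryManifold.boundaryData 3 (Base g)).incl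
            (seamDiffeo bX (bBase g) Ψ ((beltMap D j).boundaryTube.toHomeo (circlePt (p 2), L p))))).1) p
          (EuclideanSpace.single (0 : Fin 3) (1 : ℝ)))
        (mfderiv 𝓘(ℝ, EuclideanSpace ℝ (Fin 3)) 𝓘(ℝ, EuclideanSpace ℝ (Fin 4))
          (fun p : EuclideanSpace ℝ (Fin 3) => (E ((BoundaryManifold.boundaryData 3 (Base g)).incl
            (seamDiffeo bX (bBase g) Ψ ((beltMap D j).boundaryTube.toHomeo (circlePt (p 2), L p))))).1) p
          (EuclideanSpace.single (1 : Fin 3) (1 : ℝ)))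
        (mfderiv 𝓘(ℝ, EuclideanSpace ℝ (Fin 3)) 𝓘(ℝ, EuclideanSpace ℝ (Fin 4))
          (fun p : EuclideanSpace ℝ (Fin 3) => (E ((BoundaryManifold.boundaryData 3 (Base g)).incl
            (seamDiffeo bX (bBase g) Ψ ((beltMap D j).boundaryTube.toHomeo (circlePt (p 2), L p))))).1) p
          (EuclideanSpace.single (2 : Fin 3) (1 : ℝ))) *
      det4 (gradient (rho g) (E ((BoundaryManifold.boundaryData 3 (Base g)).incl (seamDiffeo bX (bBase g) Ψ
          ((beltMap D j).boundaryTube.toHomeo (circlePt (p' 2), L p'))))).1)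
        (mfderiv 𝓘(ℝ, EuclideanSpace ℝ (Fin 3)) 𝓘(ℝ, EuclideanSpace ℝ (Fin 4))
          (fun p : EuclideanSpace ℝ (Fin 3) => (E ((BoundaryManifold.boundaryData 3 (Base g)).incl
            (seamDiffeo bX (bBase g) Ψ ((beltMap D j).boundaryTube.toHomeo (circlePt (p 2), L p))))).1) p'
          (EuclideanSpace.single (0 : Fin 3) (1 : ℝ)))
        (mfderiv 𝓘(ℝ, EuclideanSpace ℝ (Fin 3)) 𝓘(ℝ, EuclideanSpace ℝ (Fin 4))
          (fun p : EuclideanSpace ℝ (Fin 3) => (E ((BoundaryManifold.boundaryData 3 (Base g)).incl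
            (seamDiffeo bX (bBase g) Ψ ((beltMap D j).boundaryTube.toHomeo (circlePt (p 2), L p))))).1) p'
          (EuclideanSpace.single (1 : Fin 3) (1 : ℝ)))
        (mfderiv 𝓘(ℝ, EuclideanSpace ℝ (Fin 3)) 𝓘(ℝ, EuclideanSpace ℝ (Fin 4))
          (fun p : EuclideanSpace ℝ (Fin 3) => (E ((BoundaryManifold.boundaryData 3 (Base g)).incl
            (seamDiffeo bX (bBase g) Ψ ((beltMap D j).boundaryTube.toHomeo (circlePt (p 2), L p))))).1) p'
          (EuclideanSpace.single (2 : Fin 3) (1 : ℝ))) :=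
  mul_pos_of_continuousOn_convex (convex_beltChartDom L) (continuousOn_beltChar D bX Ψ E j (L := L))
    (fun q hq => det4_beltChart₃_ne_zero D bX Ψ E j hL hEρ q hq) hp hp'

end Chart

/-- **Sub-goal `helper_beltChar_radialConst` of stub `stub_T3_dualPresentation`** (T3 ▸ node `Hgap` ▸ part B
`helper_Hgap_twisting` ▸ transfer step (R6a′), sphere side; wave 7, lead c5, worker H1): the
`det4`-orientation character `χ` of the three-dimensional belt-tube chart
`Γ p = (E (seam (β♭ (circlePt (p 2), L p)))).1` (any `rho`-preserving diffeomorphism `E`, `L` the fibre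
part) has ONE sign on the whole chart domain `‖L p‖ < 1` (in particular along radial segments):
`0 < χ p · χ p'`.  `let`-form of `beltChar_sign_const`. [cite: LeeSmoothManifolds2013, Prop. 15.24] -/
theorem helper_beltChar_radialConst : ∀ (g : ℕ) (ι : Type) [Finite ι] (h : ι → Literature.Topology.FourManifolds.HandleAttachingMap 3 2 (Literature.Topology.FourManifolds.LefschetzBase.Base g)) (X : Type) [TopologicalSpace X] [ChartedSpace (EuclideanHalfSpace 4) X] [IsManifold (𝓡∂ 4) ∞ X] (D : Literature.Topology.FourManifolds.HandleAttachingMap.MultiAttachmentData h (𝓡∂ 4) X) (bX : Literature.Topology.FourManifolds.BoundaryData (𝓡∂ 4) X (𝓡 3)) (Ψ : bX.carrier ≃ₘ⟮𝓡 3, 𝓡 3⟯ (Literature.Topology.FourManifolds.LefschetzBase.bBase g).carrier) (E : Literature.Topology.FourManifolds.LefschetzBase.Base g ≃ₘ^∞⟮𝓡∂ 4, 𝓡∂ 4⟯ Literature.Topology.FourManifolds.LefschetzBase.Base g) (j : ι) (L : EuclideanSpace ℝ (Fin 3) →L[ℝ] EuclideanSpace ℝ (Fin 2)), (∀ (p :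 EuclideanSpace ℝ (Fin 3)) (i : Fin 2), L p i = p (Fin.castSucc i)) → (∀ x : Literature.Topology.FourManifolds.LefschetzBase.Base g, Literature.Topology.FourManifolds.LefschetzBase.rho g (E x).1 = Literature.Topology.FourManifolds.LefschetzBase.rho g x.1) → let Γ : EuclideanSpace ℝ (Fin 3) → EuclideanSpace ℝ (Fin 4) := fun p => (E ((Literature.Topology.FourManifolds.BoundaryManifold.boundaryData 3 (Literature.Topology.FourManifolds.LefschetzBase.Base g)).incl (Summit.SmoothPoincare4.SmoothPoincare4.Theorems.AcyclicBisectionExists.ModpBraidOrbits.seamDiffeo bX (Literature.Topology.FourManifolds.LefschetzBase.bBase g) Ψ ((Summit.SmoothPoincare4.SmoothPoincare4.Theorems.AcyclicBisectionExists.ModpBraidOrbits.beltMap D j).boundaryTube.toHomeo (Literature.Topology.FourManifolds.circlePt (p 2), L p))))).1; let χ : EuclideanSpace ℝ (Fin 3) → ℝ := fun p => Literature.Geometry.Symplectic.det4 (gradient (Literature.Topology.FourManifolds.LefschetzBase.rho g) (Γ p)) (mfderiv 𝓘(ℝ, EuclideanSpace ℝ (Fin 3)) 𝓘(ℝ, EuclideanSpace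 ℝ (Fin 4)) Γ p (EuclideanSpace.single (0 : Fin 3) (1 : ℝ))) (mfderiv 𝓘(ℝ, EuclideanSpace ℝ (Fin 3)) 𝓘(ℝ, EuclideanSpace ℝ (Fin 4)) Γ p (EuclideanSpace.single (1 : Fin 3) (1 : ℝ))) (mfderiv 𝓘(ℝ, EuclideanSpace ℝ (Fin 3)) 𝓘(ℝ, EuclideanSpace ℝ (Fin 4)) Γ p (EuclideanSpace.single (2 : Fin 3) (1 : ℝ))); ∀ (p p' : EuclideanSpace ℝ (Fin 3)), ‖L p‖ < 1 → ‖L p'‖ < 1 → 0 < χ p * χ p' :=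
  fun _ _ _ _ _ _ _ _ D bX Ψ E j _ hL hEρ p p' hp hp' => beltChar_sign_const D bX Ψ E j hL hEρ p p' hp hp'

end Summit.SmoothPoincare4.SmoothPoincare4.Theorems.AcyclicBisectionExists.ModpBraidOrbits

end
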